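/-
Copyright: the b2b-balaban T⁴-continuum CRUX team, row NE7b leaf lineage `t4-ne7b-formalise-leaf-06` (gen 147). Project licence.
-/
import Summits.QuantumFields.BalabanUV.T4Continuum.Spine.NE7b.ConvexSlabWindowMass

/-!
# THE SLAB WINDOW ABOUT THE TILTED MEANS: the `hmass` letter of the convexity road in the road's OWN letters
# (`λ`, `ρ`, `|ι|`, the tilted first ∕ second moments) — Chebyshev at one deviation + Brascamp–Lieb (IN THE TREE) + Maurey's tails
# (row NE7b, node U5c; companion of `…ConvexSlabWindowMass`; kernel lemmas of real analysis)

Cell `pub-balaban`, sub-cell `t4`, spine estimate NE7b (`T4WeightBudget.RelWeightBound`; the cell's OWN estimate — NOT PRINTED in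
[Bałaban 1983–89], NOT PROVED).  Crux-route work under `Spine/NE7b/` by a row leaf on the convexity road; NOTHING of Bałaban's is named
or asserted; no `T4Continuum/Support` leaf typed; no `def`; zero `sorry`.

WHY.  `…ConvexSlabWindowMass.slabWindowMass_ge` supplies the window-mass letter `hmass` of
`…ConvexTiltMoment.exp_moment_le_of_uniformlyConvex_window` for slab ∕ per-bond windows `{∀ i, |⟪u_i,y⟫ − c_i| < ρ}` with
`η = 2|ι|e^{−λρ²∕4}∕θ`, DISPLAYING centres `c_i` whose two closed half-spaces carry the fraction `θ` of the mass.  The convexity road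
already displays the TILTED MEANS `m_i = ∫⟪u_i,x⟫ dν_V` ((R1″)-class objects) and the Brascamp–Lieb variance bound is IN THE TREE.
THIS FILE puts the window AT THE TILTED MEANS and removes `θ`: by Chebyshev at one deviation `s = √(2∕λ)` (variance `≤ ‖u‖²∕λ ≤ 1∕λ`
by `ConvexTiltMoment.sq_moment_inner_le`), the closed half-spaces `{⟪u_i,x⟫ ≤ m_i + s}` and `{m_i − s ≤ ⟪u_i,x⟫}` carry `≥ ½Z`;
Maurey's one-sided tails (`…ConvexSlabWindowMass.tailMass_le_of_halfSpaceMass`) from those levels give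
`η = 4|ι|·e^{−λ(ρ − √(2∕λ))²∕4}` for `ρ ≥ √(2∕λ)` — letters: `λ`, `ρ`, `|ι|`, and the integrability of `⟪u_i,·⟫`, `⟪u_i,·⟫²` under the
tilt (the SAME `h1 ∕ h2` binders as `ConvexTiltMoment`; dischargeable from the convexity letter by `…UniformlyConvexTiltedMoments` §2).

WHAT IS PROVED ([folklore]): §1 **`slabWindowMass_ge_of_tailBounds`** (no convexity: one-sided tail bounds `τ` per constraint ⇒
`Z − 2|ι|τ ≤ ∫_K e^{−V}`); §2 **`halfSpaceMass_ge_of_sqDeviation`** ∕ **`halfSpaceMass_ge_of_sqDeviation'`** (Chebyshev in `e^{−V}`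
letters: `Z − D∕s² ≤ ∫_{⟪u,x⟫ ≤ m + s} e^{−V}` and `≤ ∫_{m − s ≤ ⟪u,x⟫} e^{−V}`, `D = ∫e^{−V}(⟪u,x⟫ − m)²`, ANY `m`); §3
**`sqDeviation_tiltedMean_le`** (`D ≤ Z·λ⁻¹‖u‖²` at `m =` the tilted mean — the tree's Brascamp–Lieb BY NAME) and
**`integrable_sqDeviation_of_tilted`**; §4 **`slabWindowMass_ge_at_tiltedMeans`** — for `ρ ≥ √(2∕λ)`:
`(1 − 4|ι|e^{−λ(ρ−√(2∕λ))²∕4})·∫e^{−V} ≤ ∫_{∀ i, |⟪u_i,x⟫ − m_i| < ρ} e^{−V}`; `slabWindowMass_ge_of_tiltedMeans_near` (RE-CENTRING at prescribed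
centres `c_i` with `|m_i − c_i| ≤ δ` — the road's (R1″) letter on the tilted means: half-width `ρ − δ` about `m` sits inside half-width
`ρ` about `c`); §5 **`exp_moment_le_of_uniformlyConvex_slabWindow_at_tiltedMeans`** ∕ **`…_near_tiltedMeans`** — the OWNER's window END
BY NAME with `K :=` the slab about the tilted means (resp. about prescribed centres) and `hmass` SUPPLIED (displayed: `hη`, resp.
`hδ, hη`, besides the road's own binders).

NOT HERE (honest): the identification of print's small-field windows ∕ centres ∕ per-bond functionals and of `λ, ρ` BY VALUE ((A1c)
readings); anything of Bałaban's.  NE7b NOT PRINTED ∕ NOT PROVED; spine PROVED 0∕9; rung (B)+1 on a FINITE torus — NOT infinite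
volume, NOT the mass gap, NOT Clay.
HONEST DEPENDENCY: continuum YM on T⁴ ⇐ BetaPertH ∧ nine spine estimates (0/9 proved); BetaPertH ⇐ (D1) ∧ (D4) ∧ CAP+tail.
-/

set_option autoImplicit false

noncomputable section

open MeasureTheory Real
open scoped RealInnerProductSpace

namespace Summit.QuantumFields.BalabanUV.T4Continuum.NE7b.ConvexSlabWindowTiltedMeans

open Summit.QuantumFields.BalabanUV.T4Continuum.NE7b.ConvexSlabWindowMass

variable {n : ℕ}

/-! ## §1 The slab window from one-sided tail bounds (no convexity) -/

/-- **THE SLAB WINDOW FROM ONE-SIDED TAIL BOUNDS**: if for every constraint both one-sided tails beyond half-width `ρ` about `c_i` have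
`e^{−V}`-mass `≤ τ`, then `∫e^{−V} − 2|ι|τ ≤ ∫_{∀ i, |⟪u_i,x⟫ − c_i| < ρ} e^{−V}` (union bound; no convexity). [folklore] -/
theorem slabWindowMass_ge_of_tailBounds {ι : Type*} [Fintype ι] {V : EuclideanSpace ℝ (Fin n) → ℝ}
    (hZ : Integrable fun x => exp (-V x)) (u : ι → EuclideanSpace ℝ (Fin n)) (c : ι → ℝ) (ρ : ℝ) {τ : ℝ}
    (hup : ∀ i, ∫ x in {x | c i + ρ ≤ ⟪u i, x⟫}, exp (-V x) ≤ τ)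
    (hdn : ∀ i, ∫ x in {x | ⟪u i, x⟫ ≤ c i - ρ}, exp (-V x) ≤ τ) :
    (∫ z, exp (-V z)) - 2 * Fintype.card ι * τ ≤ ∫ x in {x | ∀ i, |⟪u i, x⟫ - c i| < ρ}, exp (-V x) := by
  classical
  set K : Set (EuclideanSpace ℝ (Fin n)) := {x | ∀ i, |⟪u i, x⟫ - c i| < ρ} with hK
  set U : ι → Set (EuclideanSpace ℝ (Fin n)) := fun i => {x | c i + ρ ≤ ⟪u i, x⟫} with hU
  set L : ι → Set (EuclideanSpace ℝ (Fin n)) := fun i => {x | ⟪u i, x⟫ ≤ c i - ρ} with hL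
  have hum : ∀ i, Measurable fun x : EuclideanSpace ℝ (Fin n) => ⟪u i, x⟫ :=
    fun i => (continuous_const.inner continuous_id).measurable
  have hUm : ∀ i, MeasurableSet (U i) := fun i => measurableSet_le measurable_const (hum i)
  have hLm : ∀ i, MeasurableSet (L i) := fun i => measurableSet_le (hum i) measurable_const
  have hKeq : K = ⋂ i, {x | |⟪u i, x⟫ - c i| < ρ} := by ext x; simp [hK]
  have hKm : MeasurableSet K := by
    rw [hKeq]
    exact MeasurableSet.iInter fun i =>
      measurableSet_lt (continuous_abs.measurable.comp ((hum i).sub measurable_const)) measurable_const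
  have hnn : ∀ (s : Set (EuclideanSpace ℝ (Fin n))) (x : EuclideanSpace ℝ (Fin n)),
      0 ≤ s.indicator (fun x => exp (-V x)) x :=
    fun s x => Set.indicator_nonneg (fun _ _ => (exp_pos _).le) _
  have hcover : ∀ x, Kᶜ.indicator (fun x => exp (-V x)) x ≤
      ∑ i, ((U i).indicator (fun x => exp (-V x)) x + (L i).indicator (fun x => exp (-V x)) x) := by
    intro x
    by_cases hx : x ∈ Kᶜ
    · obtain ⟨i, hi⟩ : ∃ i, ρ ≤ |⟪u i, x⟫ - c i| := by
        simpa [hK, not_lt] using hx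
      rw [Set.indicator_of_mem hx]
      refine le_trans ?_ (Finset.single_le_sum (fun j _ => add_nonneg (hnn _ _) (hnn _ _)) (Finset.mem_univ i))
      rcases le_abs'.1 hi with h | h
      · have hxL : x ∈ L i := by show ⟪u i, x⟫ ≤ c i - ρ; linarith
        rw [Set.indicator_of_mem hxL]
        linarith [hnn (U i) x]
      · have hxU : x ∈ U i := by show c i + ρ ≤ ⟪u i, x⟫; linarith
        rw [Set.indicator_of_mem hxU]
        linarith [hnn (L i) x]
    · rw [Set.indicator_of_notMem hx]
      exact Finset.sum_nonneg fun j _ => add_nonneg (hnn _ _) (hnn _ _)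
  have hint : ∀ i, Integrable (fun x => (U i).indicator (fun x => exp (-V x)) x +
      (L i).indicator (fun x => exp (-V x)) x) := fun i => (hZ.indicator (hUm i)).add (hZ.indicator (hLm i))
  have hcompl : ∫ x in Kᶜ, exp (-V x) ≤ ∑ i, ((∫ x in U i, exp (-V x)) + ∫ x in L i, exp (-V x)) := by
    calc ∫ x in Kᶜ, exp (-V x) = ∫ x, Kᶜ.indicator (fun x => exp (-V x)) x := (integral_indicator hKm.compl).symm
      _ ≤ ∫ x, ∑ i, ((U i).indicator (fun x => exp (-V x)) x + (L i).indicator (fun x => exp (-V x)) x) :=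
          integral_mono (hZ.indicator hKm.compl) (integrable_finsetSum _ fun i _ => hint i) hcover
      _ = ∑ i, ((∫ x in U i, exp (-V x)) + ∫ x in L i, exp (-V x)) := by
          rw [integral_finsetSum _ fun i _ => hint i]
          refine Finset.sum_congr rfl fun i _ => ?_
          rw [integral_add (hZ.indicator (hUm i)) (hZ.indicator (hLm i)), integral_indicator (hUm i),
            integral_indicator (hLm i)]
  have hsum : ∑ i, ((∫ x in U i, exp (-V x)) + ∫ x in L i, exp (-V x)) ≤ Fintype.card ι * (2 * τ) := by
    calc ∑ i, ((∫ x in U i, exp (-V x)) + ∫ x in L i, exp (-V x)) ≤ ∑ _i : ι, 2 * τ :=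
          Finset.sum_le_sum fun i _ => by linarith [hup i, hdn i]
      _ = Fintype.card ι * (2 * τ) := by rw [Finset.sum_const, Finset.card_univ, nsmul_eq_mul]
  have hsplit := integral_add_compl hKm hZ
  have hKval : ∫ x in K, exp (-V x) = (∫ z, exp (-V z)) - ∫ x in Kᶜ, exp (-V x) := by linarith [hsplit]
  rw [hKval]
  linarith [hcompl, hsum]

/-! ## §2 Chebyshev at one deviation, in `e^{−V}` letters -/

/-- **CHEBYSHEV, UPPER SIDE**: for any centre `m` and `s > 0`, `∫e^{−V} − D∕s² ≤ ∫_{⟪u,x⟫ ≤ m + s} e^{−V}` with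
`D = ∫ e^{−V}·(⟪u,x⟫ − m)²` (pointwise `𝟙_{⟪u,x⟫ > m+s} ≤ (⟪u,x⟫ − m)²∕s²`). [folklore] -/
theorem halfSpaceMass_ge_of_sqDeviation {V : EuclideanSpace ℝ (Fin n) → ℝ} (hZ : Integrable fun x => exp (-V x))
    (u : EuclideanSpace ℝ (Fin n)) (m : ℝ) {s : ℝ} (hs : 0 < s)
    (hD : Integrable fun x => exp (-V x) * (⟪u, x⟫ - m) ^ 2) :
    (∫ z, exp (-V z)) - (∫ x, exp (-V x) * (⟪u, x⟫ - m) ^ 2) / s ^ 2 ≤ ∫ x in {x | ⟪u, x⟫ ≤ m + s}, exp (-V x) := by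
  set A : Set (EuclideanSpace ℝ (Fin n)) := {x | ⟪u, x⟫ ≤ m + s} with hA
  have hum : Measurable fun x : EuclideanSpace ℝ (Fin n) => ⟪u, x⟫ := (continuous_const.inner continuous_id).measurable
  have hAm : MeasurableSet A := measurableSet_le hum measurable_const
  have hsplit := integral_add_compl hAm hZ
  have htail : ∫ x in Aᶜ, exp (-V x) ≤ (∫ x, exp (-V x) * (⟪u, x⟫ - m) ^ 2) / s ^ 2 := by
    rw [← integral_indicator hAm.compl, ← integral_div]
    refine integral_mono (hZ.indicator hAm.compl) (hD.div_const _) fun x => ?_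
    by_cases hx : x ∈ Aᶜ
    · rw [Set.indicator_of_mem hx]
      have hx' : m + s < ⟪u, x⟫ := not_le.1 hx
      have h1 : s ^ 2 ≤ (⟪u, x⟫ - m) ^ 2 := pow_le_pow_left₀ hs.le (by linarith) 2
      have h2 : (1 : ℝ) ≤ (⟪u, x⟫ - m) ^ 2 / s ^ 2 := by rw [le_div_iff₀ (by positivity)]; linarith
      calc exp (-V x) = exp (-V x) * 1 := (mul_one _).symm
        _ ≤ exp (-V x) * ((⟪u, x⟫ - m) ^ 2 / s ^ 2) := mul_le_mul_of_nonneg_left h2 (exp_pos _).le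
        _ = exp (-V x) * (⟪u, x⟫ - m) ^ 2 / s ^ 2 := by ring
    · rw [Set.indicator_of_notMem hx]
      positivity
  linarith

/-- **CHEBYSHEV, LOWER SIDE**: `∫e^{−V} − D∕s² ≤ ∫_{m − s ≤ ⟪u,x⟫} e^{−V}` (the upper side at `−u, −m`). [folklore] -/
theorem halfSpaceMass_ge_of_sqDeviation' {V : EuclideanSpace ℝ (Fin n) → ℝ} (hZ : Integrable fun x => exp (-V x))
    (u : EuclideanSpace ℝ (Fin n)) (m : ℝ) {s : ℝ} (hs : 0 < s)
    (hD : Integrable fun x => exp (-V x) * (⟪u, x⟫ - m) ^ 2) :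
    (∫ z, exp (-V z)) - (∫ x, exp (-V x) * (⟪u, x⟫ - m) ^ 2) / s ^ 2 ≤ ∫ x in {x | m - s ≤ ⟪u, x⟫}, exp (-V x) := by
  have hsq : ∀ x : EuclideanSpace ℝ (Fin n), (⟪-u, x⟫ - -m) ^ 2 = (⟪u, x⟫ - m) ^ 2 := fun x => by
    rw [inner_neg_left]; ring
  have hD' : Integrable fun x => exp (-V x) * (⟪-u, x⟫ - -m) ^ 2 := by simp_rw [hsq]; exact hD
  have h := halfSpaceMass_ge_of_sqDeviation hZ (-u) (-m) hs hD'
  have hA : {x : EuclideanSpace ℝ (Fin n) | ⟪-u, x⟫ ≤ -m + s} = {x | m - s ≤ ⟪u, x⟫} := by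
    ext x; simp only [Set.mem_setOf_eq, inner_neg_left]; constructor <;> intro h <;> linarith
  simp_rw [hsq] at h
  rwa [hA] at h

/-! ## §3 The squared deviation about the tilted mean (Brascamp–Lieb, in the tree) -/

/-- The squared deviation of `⟪u,·⟫` about any centre is `e^{−V}`-integrable when `⟪u,·⟫` and `⟪u,·⟫²` are integrable under the tilt
`ν_V = e^{−V}dx∕Z` (the road's `h1 ∕ h2` binders). [folklore] -/
theorem integrable_sqDeviation_of_tilted {V : EuclideanSpace ℝ (Fin n) → ℝ} (hZ : Integrable fun x => exp (-V x))
    (u : EuclideanSpace ℝ (Fin n)) (m : ℝ)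
    (h1 : Integrable (fun x => ⟪u, x⟫) (volume.tilted fun x => -V x))
    (h2 : Integrable (fun x => ⟪u, x⟫ ^ 2) (volume.tilted fun x => -V x)) :
    Integrable fun x => exp (-V x) * (⟪u, x⟫ - m) ^ 2 := by
  have hν : Integrable (fun x => (⟪u, x⟫ - m) ^ 2) (volume.tilted fun x => -V x) := by
    have h := (h2.sub (h1.const_mul (2 * m))).add (integrable_const (m ^ 2))
    refine h.congr (ae_of_all _ fun x => ?_)
    simp only [Pi.add_apply, Pi.sub_apply]
    ring
  have h := (integrable_tilted_iff hZ (fun x => (⟪u, x⟫ - m) ^ 2)).1 hν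
  refine h.congr (ae_of_all _ fun x => ?_)
  simp only [smul_eq_mul]

/-- **THE SQUARED DEVIATION ABOUT THE TILTED MEAN IS AT MOST `Z·λ⁻¹‖u‖²`**: with `m = ∫⟪u,x⟫ dν_V`,
`∫ e^{−V}(⟪u,x⟫ − m)² ≤ (∫e^{−V})·λ⁻¹‖u‖²` — the tree's Brascamp–Lieb variance bound (`ConvexTiltMoment.sq_moment_inner_le`) BY NAME,
transported from `ν_V` to `e^{−V}dx`. [folklore] -/
theorem sqDeviation_tiltedMean_le {V : EuclideanSpace ℝ (Fin n) → ℝ} {lam : ℝ} (hlam : 0 < lam) (hVc : Continuous V)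
    (hV : ∀ x y : EuclideanSpace ℝ (Fin n), V x + ⟪gradient V x, y - x⟫ + lam / 2 * ‖y - x‖ ^ 2 ≤ V y)
    (hZ : Integrable fun x => exp (-V x)) (u : EuclideanSpace ℝ (Fin n))
    (h1 : Integrable (fun x => ⟪u, x⟫) (volume.tilted fun x => -V x))
    (h2 : Integrable (fun x => ⟪u, x⟫ ^ 2) (volume.tilted fun x => -V x)) :
    ∫ x, exp (-V x) * (⟪u, x⟫ - ∫ y, ⟪u, y⟫ ∂(volume.tilted fun x => -V x)) ^ 2 ≤
      (∫ z, exp (-V z)) * (lam⁻¹ * ‖u‖ ^ 2) := by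
  set ν : Measure (EuclideanSpace ℝ (Fin n)) := volume.tilted fun x => -V x with hν
  haveI : IsProbabilityMeasure ν := isProbabilityMeasure_tilted hZ
  set m : ℝ := ∫ y, ⟪u, y⟫ ∂ν with hm
  set Z : ℝ := ∫ z, exp (-V z) with hZdef
  have hZpos : 0 < Z := integral_exp_pos hZ
  -- the variance under `ν` is at most `λ⁻¹‖u‖²`
  have hsq := ConvexTiltMoment.sq_moment_inner_le hlam hVc hV hZ u h1 h2
  have hvar : ∫ x, (⟪u, x⟫ - m) ^ 2 ∂ν ≤ lam⁻¹ * ‖u‖ ^ 2 := by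
    have hexp : ∫ x, (⟪u, x⟫ - m) ^ 2 ∂ν = (∫ x, ⟪u, x⟫ ^ 2 ∂ν) - 2 * m * (∫ x, ⟪u, x⟫ ∂ν) + m ^ 2 := by
      have e1 : ∀ x : EuclideanSpace ℝ (Fin n), (⟪u, x⟫ - m) ^ 2 = (⟪u, x⟫ ^ 2 - 2 * m * ⟪u, x⟫) + m ^ 2 :=
        fun x => by ring
      simp_rw [e1]
      rw [integral_add ?_ (integrable_const _), integral_sub h2 (h1.const_mul _),
        integral_const_mul, integral_const, smul_eq_mul, probReal_univ, one_mul]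
      exact h2.sub (h1.const_mul _)
    rw [hexp, ← hm]
    nlinarith [hsq]
  -- transport `∫ e^{−V} g = Z · ∫ g dν`
  have htr : ∫ x, exp (-V x) * (⟪u, x⟫ - m) ^ 2 = Z * ∫ x, (⟪u, x⟫ - m) ^ 2 ∂ν := by
    rw [hν, integral_tilted]
    simp_rw [smul_eq_mul]
    rw [← hZdef]
    have e2 : ∀ x : EuclideanSpace ℝ (Fin n), exp (-V x) / Z * (⟪u, x⟫ - m) ^ 2 = Z⁻¹ * (exp (-V x) * (⟪u, x⟫ - m) ^ 2) :=
      fun x => by rw [div_eq_mul_inv]; ring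
    simp_rw [e2]
    rw [integral_const_mul, ← mul_assoc, mul_inv_cancel₀ hZpos.ne', one_mul]
  rw [htr]
  exact mul_le_mul_of_nonneg_left hvar hZpos.le

/-! ## §4 The slab window about the tilted means -/

/-- **THE SLAB WINDOW ABOUT THE TILTED MEANS CARRIES ALL BUT `η = 4|ι|e^{−λ(ρ−√(2∕λ))²∕4}`**: for `V` continuous and `λ`-uniformly
convex with `e^{−V}` integrable, functionals `‖u_i‖ ≤ 1` with `⟪u_i,·⟫, ⟪u_i,·⟫² ∈ L¹(ν_V)`, and half-width `ρ ≥ √(2∕λ)`: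
`(1 − η)·∫e^{−V} ≤ ∫_{∀ i, |⟪u_i,x⟫ − m_i| < ρ} e^{−V}`, `m_i = ∫⟪u_i,x⟫ dν_V` — the `hmass` letter at the road's own centres, with no
`θ`, no `Λ`, no symmetry, no critical point. [folklore] -/
theorem slabWindowMass_ge_at_tiltedMeans {ι : Type*} [Fintype ι] {V : EuclideanSpace ℝ (Fin n) → ℝ} {lam : ℝ}
    (hlam : 0 < lam) (hVc : Continuous V)
    (hV : ∀ x y : EuclideanSpace ℝ (Fin n), V x + ⟪gradient V x, y - x⟫ + lam / 2 * ‖y - x‖ ^ 2 ≤ V y)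
    (hZ : Integrable fun x => exp (-V x)) (u : ι → EuclideanSpace ℝ (Fin n)) (hu : ∀ i, ‖u i‖ ≤ 1)
    (h1 : ∀ i, Integrable (fun x => ⟪u i, x⟫) (volume.tilted fun x => -V x))
    (h2 : ∀ i, Integrable (fun x => ⟪u i, x⟫ ^ 2) (volume.tilted fun x => -V x))
    {ρ : ℝ} (hρ : Real.sqrt (2 / lam) ≤ ρ) :
    (1 - 4 * Fintype.card ι * exp (-(lam * (ρ - Real.sqrt (2 / lam)) ^ 2 / 4))) * ∫ z, exp (-V z) ≤
      ∫ x in {x | ∀ i, |⟪u i, x⟫ - ∫ y, ⟪u i, y⟫ ∂(volume.tilted fun x => -V x)| < ρ}, exp (-V x) := by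
  set Z : ℝ := ∫ z, exp (-V z) with hZdef
  have hZpos : 0 < Z := integral_exp_pos hZ
  set s : ℝ := Real.sqrt (2 / lam) with hs
  have hs0 : 0 < s := Real.sqrt_pos.2 (by positivity)
  have hs2 : s ^ 2 = 2 / lam := Real.sq_sqrt (by positivity)
  set ε : ℝ := exp (-(lam * (ρ - s) ^ 2 / 4)) with hε
  set m : ι → ℝ := fun i => ∫ y, ⟪u i, y⟫ ∂(volume.tilted fun x => -V x) with hm
  have hρs : 0 ≤ ρ - s := sub_nonneg.2 hρ
  -- one deviation beyond the mean, each closed half-space carries half the mass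
  have hDle : ∀ i, (∫ x, exp (-V x) * (⟪u i, x⟫ - m i) ^ 2) / s ^ 2 ≤ Z / 2 := by
    intro i
    have hD := sqDeviation_tiltedMean_le hlam hVc hV hZ (u i) (h1 i) (h2 i)
    have hu1 : ‖u i‖ ^ 2 ≤ 1 := by
      have := hu i
      nlinarith [norm_nonneg (u i)]
    have hD' : ∫ x, exp (-V x) * (⟪u i, x⟫ - m i) ^ 2 ≤ Z * lam⁻¹ := by
      calc ∫ x, exp (-V x) * (⟪u i, x⟫ - m i) ^ 2 ≤ Z * (lam⁻¹ * ‖u i‖ ^ 2) := hD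
        _ ≤ Z * (lam⁻¹ * 1) := mul_le_mul_of_nonneg_left (mul_le_mul_of_nonneg_left hu1 (by positivity)) hZpos.le
        _ = Z * lam⁻¹ := by rw [mul_one]
    rw [div_le_iff₀ (by positivity), hs2]
    have : Z * lam⁻¹ = Z / 2 * (2 / lam) := by field_simp
    linarith
  have hlo : ∀ i, 1 / 2 * Z ≤ ∫ x in {x | ⟪u i, x⟫ ≤ m i + s}, exp (-V x) := by
    intro i
    have h := halfSpaceMass_ge_of_sqDeviation hZ (u i) (m i) hs0
      (integrable_sqDeviation_of_tilted hZ (u i) (m i) (h1 i) (h2 i))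
    linarith [hDle i]
  have hhi : ∀ i, 1 / 2 * Z ≤ ∫ x in {x | m i - s ≤ ⟪u i, x⟫}, exp (-V x) := by
    intro i
    have h := halfSpaceMass_ge_of_sqDeviation' hZ (u i) (m i) hs0
      (integrable_sqDeviation_of_tilted hZ (u i) (m i) (h1 i) (h2 i))
    linarith [hDle i]
  -- Maurey's tails from those levels
  have hup : ∀ i, ∫ x in {x | m i + ρ ≤ ⟪u i, x⟫}, exp (-V x) ≤ 2 * ε * Z := by
    intro i
    have h := tailMass_le_of_halfSpaceMass hlam hVc hV hZ (hu i) (m i + s) hρs (by norm_num : (0 : ℝ) < 1 / 2) (hlo i)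
    have e : m i + s + (ρ - s) = m i + ρ := by ring
    rw [e] at h
    calc ∫ x in {x | m i + ρ ≤ ⟪u i, x⟫}, exp (-V x) ≤ ε * Z / (1 / 2) := h
      _ = 2 * ε * Z := by ring
  have hdn : ∀ i, ∫ x in {x | ⟪u i, x⟫ ≤ m i - ρ}, exp (-V x) ≤ 2 * ε * Z := by
    intro i
    have h := lowerTailMass_le_of_halfSpaceMass hlam hVc hV hZ (hu i) (m i - s) hρs (by norm_num : (0 : ℝ) < 1 / 2) (hhi i)
    have e : m i - s - (ρ - s) = m i - ρ := by ring
    rw [e] at h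
    calc ∫ x in {x | ⟪u i, x⟫ ≤ m i - ρ}, exp (-V x) ≤ ε * Z / (1 / 2) := h
      _ = 2 * ε * Z := by ring
  have h := slabWindowMass_ge_of_tailBounds hZ u m ρ hup hdn
  have halg : (1 - 4 * Fintype.card ι * ε) * Z = Z - 2 * Fintype.card ι * (2 * ε * Z) := by ring
  rw [halg]
  exact h

/-- **RE-CENTRING AT PRESCRIBED CENTRES**: if every tilted mean `m_i = ∫⟪u_i,x⟫dν_V` lies within `δ` of a prescribed centre `c_i`
(the road's (R1″) letter on the tilted means), the slab of half-width `ρ` about `c` CONTAINS the slab of half-width `ρ − δ` about the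
tilted means; hence for `ρ − δ ≥ √(2∕λ)`: `(1 − 4|ι|e^{−λ(ρ−δ−√(2∕λ))²∕4})·∫e^{−V} ≤ ∫_{∀ i, |⟪u_i,x⟫ − c_i| < ρ} e^{−V}`. [folklore] -/
theorem slabWindowMass_ge_of_tiltedMeans_near {ι : Type*} [Fintype ι] {V : EuclideanSpace ℝ (Fin n) → ℝ} {lam : ℝ}
    (hlam : 0 < lam) (hVc : Continuous V)
    (hV : ∀ x y : EuclideanSpace ℝ (Fin n), V x + ⟪gradient V x, y - x⟫ + lam / 2 * ‖y - x‖ ^ 2 ≤ V y)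
    (hZ : Integrable fun x => exp (-V x)) (u : ι → EuclideanSpace ℝ (Fin n)) (hu : ∀ i, ‖u i‖ ≤ 1)
    (h1 : ∀ i, Integrable (fun x => ⟪u i, x⟫) (volume.tilted fun x => -V x))
    (h2 : ∀ i, Integrable (fun x => ⟪u i, x⟫ ^ 2) (volume.tilted fun x => -V x))
    (c : ι → ℝ) {δ ρ : ℝ} (hδ : ∀ i, |(∫ y, ⟪u i, y⟫ ∂(volume.tilted fun x => -V x)) - c i| ≤ δ)
    (hρ : Real.sqrt (2 / lam) ≤ ρ - δ) :
    (1 - 4 * Fintype.card ι * exp (-(lam * (ρ - δ - Real.sqrt (2 / lam)) ^ 2 / 4))) * ∫ z, exp (-V z) ≤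
      ∫ x in {x | ∀ i, |⟪u i, x⟫ - c i| < ρ}, exp (-V x) := by
  have h := slabWindowMass_ge_at_tiltedMeans hlam hVc hV hZ u hu h1 h2 hρ
  refine h.trans (setIntegral_mono_set hZ.integrableOn (ae_of_all _ fun _ => (exp_pos _).le)
    (ae_of_all _ fun x hx => ?_))
  intro i
  have hxi : |⟪u i, x⟫ - ∫ y, ⟪u i, y⟫ ∂(volume.tilted fun x => -V x)| < ρ - δ := hx i
  have htri : |⟪u i, x⟫ - c i| ≤ |⟪u i, x⟫ - ∫ y, ⟪u i, y⟫ ∂(volume.tilted fun x => -V x)| +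
      |(∫ y, ⟪u i, y⟫ ∂(volume.tilted fun x => -V x)) - c i| := by
    have := abs_sub_le ⟪u i, x⟫ (∫ y, ⟪u i, y⟫ ∂(volume.tilted fun x => -V x)) (c i)
    exact this
  show |⟪u i, x⟫ - c i| < ρ
  linarith [hδ i]

/-! ## §5 Junction: the OWNER's window END on the slab about the tilted means -/

/-- **THE CONVEXITY ROAD ON THE SLAB ABOUT THE TILTED MEANS** = `…ConvexTiltMoment.exp_moment_le_of_uniformlyConvex_window` BY NAME
with `K := {∀ i, |⟪w_i,y⟫ − ∫⟪w_i,x⟫dν_V| < ρ}` and `hmass` SUPPLIED by `slabWindowMass_ge_at_tiltedMeans`; displayed besides the road's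
own binders: `‖w_i‖ ≤ 1`, the `L¹(ν_V)` letters of `⟪w_i,·⟫`, `ρ ≥ √(2∕λ)` and `hη : 4|ι|e^{−λ(ρ−√(2∕λ))²∕4} < 1`. [folklore] -/
theorem exp_moment_le_of_uniformlyConvex_slabWindow_at_tiltedMeans {ι : Type*} [Fintype ι]
    {V : EuclideanSpace ℝ (Fin n) → ℝ} {lam : ℝ} {r : ℕ} (hlam : 0 < lam) (hVc : Continuous V)
    (hV : ∀ x y : EuclideanSpace ℝ (Fin n), V x + ⟪gradient V x, y - x⟫ + lam / 2 * ‖y - x‖ ^ 2 ≤ V y)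
    (hZ : Integrable fun x => exp (-V x)) (q : Fin r → ℝ) (hq : ∀ k, 0 ≤ q k) (v : Fin r → EuclideanSpace ℝ (Fin n))
    (h1 : ∀ k, Integrable (fun x => ⟪v k, x⟫) (volume.tilted fun x => -V x))
    (h2 : ∀ k, Integrable (fun x => ⟪v k, x⟫ ^ 2) (volume.tilted fun x => -V x))
    (w : ι → EuclideanSpace ℝ (Fin n)) (hw : ∀ i, ‖w i‖ ≤ 1)
    (hw1 : ∀ i, Integrable (fun x => ⟪w i, x⟫) (volume.tilted fun x => -V x))
    (hw2 : ∀ i, Integrable (fun x => ⟪w i, x⟫ ^ 2) (volume.tilted fun x => -V x))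
    {ρ : ℝ} (hρ : Real.sqrt (2 / lam) ≤ ρ)
    (hη : 4 * Fintype.card ι * exp (-(lam * (ρ - Real.sqrt (2 / lam)) ^ 2 / 4)) < 1) :
    ∫ x in {x | ∀ i, |⟪w i, x⟫ - ∫ y, ⟪w i, y⟫ ∂(volume.tilted fun x => -V x)| < ρ}, exp (-V x) ≤
      exp ((∑ k, q k * (lam⁻¹ * ‖v k‖ ^ 2 + (∫ x, ⟪v k, x⟫ ∂(volume.tilted fun x => -V x)) ^ 2)) /
          (1 - 4 * Fintype.card ι * exp (-(lam * (ρ - Real.sqrt (2 / lam)) ^ 2 / 4)))) *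
        ∫ x in {x | ∀ i, |⟪w i, x⟫ - ∫ y, ⟪w i, y⟫ ∂(volume.tilted fun x => -V x)| < ρ},
          exp (-(V x + ∑ k, q k * ⟪v k, x⟫ ^ 2)) :=
  ConvexTiltMoment.exp_moment_le_of_uniformlyConvex_window hlam hVc hV hZ q hq v h1 h2 _ hη
    (slabWindowMass_ge_at_tiltedMeans hlam hVc hV hZ w hw hw1 hw2 hρ)

/-- **THE CONVEXITY ROAD ON A SLAB ABOUT PRESCRIBED CENTRES** `c_i` with the tilted means within `δ` of them ((R1″) letter `hδ`):
the OWNER's window END BY NAME, `hmass` SUPPLIED by `slabWindowMass_ge_of_tiltedMeans_near`; displayed: `‖w_i‖ ≤ 1`, `hw1 ∕ hw2`, `hδ`,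
`ρ − δ ≥ √(2∕λ)`, `hη : 4|ι|e^{−λ(ρ−δ−√(2∕λ))²∕4} < 1`. [folklore] -/
theorem exp_moment_le_of_uniformlyConvex_slabWindow_near_tiltedMeans {ι : Type*} [Fintype ι]
    {V : EuclideanSpace ℝ (Fin n) → ℝ} {lam : ℝ} {r : ℕ} (hlam : 0 < lam) (hVc : Continuous V)
    (hV : ∀ x y : EuclideanSpace ℝ (Fin n), V x + ⟪gradient V x, y - x⟫ + lam / 2 * ‖y - x‖ ^ 2 ≤ V y)
    (hZ : Integrable fun x => exp (-V x)) (q : Fin r → ℝ) (hq : ∀ k, 0 ≤ q k) (v : Fin r → EuclideanSpace ℝ (Fin n))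
    (h1 : ∀ k, Integrable (fun x => ⟪v k, x⟫) (volume.tilted fun x => -V x))
    (h2 : ∀ k, Integrable (fun x => ⟪v k, x⟫ ^ 2) (volume.tilted fun x => -V x))
    (w : ι → EuclideanSpace ℝ (Fin n)) (hw : ∀ i, ‖w i‖ ≤ 1)
    (hw1 : ∀ i, Integrable (fun x => ⟪w i, x⟫) (volume.tilted fun x => -V x))
    (hw2 : ∀ i, Integrable (fun x => ⟪w i, x⟫ ^ 2) (volume.tilted fun x => -V x))
    (c : ι → ℝ) {δ ρ : ℝ} (hδ : ∀ i, |(∫ y, ⟪w i, y⟫ ∂(volume.tilted fun x => -V x)) - c i| ≤ δ)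
    (hρ : Real.sqrt (2 / lam) ≤ ρ - δ)
    (hη : 4 * Fintype.card ι * exp (-(lam * (ρ - δ - Real.sqrt (2 / lam)) ^ 2 / 4)) < 1) :
    ∫ x in {x | ∀ i, |⟪w i, x⟫ - c i| < ρ}, exp (-V x) ≤
      exp ((∑ k, q k * (lam⁻¹ * ‖v k‖ ^ 2 + (∫ x, ⟪v k, x⟫ ∂(volume.tilted fun x => -V x)) ^ 2)) /
          (1 - 4 * Fintype.card ι * exp (-(lam * (ρ - δ - Real.sqrt (2 / lam)) ^ 2 / 4)))) *
        ∫ x in {x | ∀ i, |⟪w i, x⟫ - c i| < ρ}, exp (-(V x + ∑ k, q k * ⟪v k, x⟫ ^ 2)) :=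
  ConvexTiltMoment.exp_moment_le_of_uniformlyConvex_window hlam hVc hV hZ q hq v h1 h2 _ hη
    (slabWindowMass_ge_of_tiltedMeans_near hlam hVc hV hZ w hw hw1 hw2 c hδ hρ)


end Summit.QuantumFields.BalabanUV.T4Continuum.NE7b.ConvexSlabWindowTiltedMeans

end
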